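import Mathlib
import Literature.Analysis.Calculus.SmoothCutoff

/-!
# `NecksCertify` (crux stmt-FinalStateConjecture-13549, route StarvedNecks) — negative side, toolkit:
# the thin-shell zero-energy resonance of Bargmann norm `1 + O(1/K)` (the "shelf" profile)

Refuter seat `refuter-cdisprove-stmt-FinalStateConjecture-13549-g3-0` (cdisprove, generation 3),
2026-08-16; workfile `Cruxes/NecksCertify/Disproof.lean` (§G).  Sorry-free, axioms `propext`,
`Classical.choice`, `Quot.sound`; Mathlib + `Literature.Analysis.Calculus.SmoothCutoff` (the
derivative of `Real.smoothTransition` vanishes off `[0,1]`).  Companion file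
`NoParkingThresholdOne.lean` uses this toolkit to show that the Bargmann threshold `η < 1` of the
picked line's model rung M2 (`NoParkingDecay`; proved as registered by the line's worker,
`StarvedNecksNecksCertifyStubNoParkingDecay`) cannot be relaxed to `η ≤ η₀` for ANY `η₀ > 1` —
generation 2 had `η₀ = 2 log 2` (`NoParkingDecaySharp.lean`); so the threshold of the lever is
EXACTLY `1`.

Contents (namespace `…Theorems.NecksCertify.Negative.Shelf`): §1 slice calculus for a `C²` profile
`F` (`∂ₜ²`, `∂ᵣ²` of `(F(r+t) + F(r−t))/2`, data at `t = 0`); §2 the smooth step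
`S = Real.smoothTransition`, `S'` (`≥ 0`, zero off `[0,1]`) and the primitive `primStep = ∫₀ S` (`= 0` on
`(−∞,0]`, `= x − 1 + primStep 1` on `[1,∞)`, `0 ≤ primStep x ≤ x`); §3 the odd SHELF PROFILE
`prof K r = (r − primStep(r−K) + primStep(−r−K))/K` (`= r/K` on `[0,K]`, `≥ 1` beyond `K`, constant beyond
`K + 1`, `≤ (K+1)/K`, smooth, `prof'' = −S'(r−K)/K` on `r ≥ 0` — the δ-shell resonance
`min(r/K, 1)` smoothed over unit width); §4 the witness fields: majorant `ν = S'(r−K)/K`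
(`∫_{(0,∞)} ν = 1/K`, Bargmann norm `∫ (s − 0)ν ≤ (K+1)/K`), potential `V = prof''/prof`
(`|V| ≤ ν`, `V·prof = prof''`), and the exact vanishing of the free field in `{t − r ≥ K + 1}`.
-/

noncomputable section

open Real Set Filter MeasureTheory Topology

namespace Summit.FinalStateConjecture.FinalStateConjecture.Theorems.NecksCertify.Negative.Shelf

/-! ## §1 Slice calculus for a `C²` profile `F` with `F' = F₁`, `F₁' = F₂` -/

section Slices

variable {F F₁ F₂ : ℝ → ℝ}

/-- `F'' = F₂` as an `iteratedDeriv`, from `F' = F₁`, `F₁' = F₂`. [folklore] -/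
theorem iteratedDeriv_two_of_hasDerivAt (hF : ∀ x, HasDerivAt F (F₁ x) x)
    (hF₁ : ∀ x, HasDerivAt F₁ (F₂ x) x) (x : ℝ) : iteratedDeriv 2 F x = F₂ x := by
  rw [iteratedDeriv_succ, iteratedDeriv_one,
    show deriv F = F₁ from funext fun x ↦ (hF x).deriv,
    show deriv F₁ = F₂ from funext fun x ↦ (hF₁ x).deriv]

/-- `t`-slice of the free field `(F(r+s) + F(r−s))/2`: first derivative. [folklore] -/
theorem hasDerivAt_slice_t (hF : ∀ x, HasDerivAt F (F₁ x) x) (r t : ℝ) :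
    HasDerivAt (fun s ↦ (F (r + s) + F (r - s)) / 2) ((F₁ (r + t) - F₁ (r - t)) / 2) t := by
  have h1 : HasDerivAt (fun s ↦ F (r + s)) (F₁ (r + t)) t := (hF (r + t)).comp_const_add r t
  have h2 : HasDerivAt (fun s ↦ F (r - s)) (-F₁ (r - t)) t := (hF (r - t)).comp_const_sub r t
  refine ((h1.add h2).div_const 2).congr_deriv ?_
  ring

/-- `∂ₜ²` of the free field slice: `(F₂(r+t) + F₂(r−t))/2`. [folklore] -/
theorem iteratedDeriv_two_slice_t (hF : ∀ x, HasDerivAt F (F₁ x) x)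
    (hF₁ : ∀ x, HasDerivAt F₁ (F₂ x) x) (r t : ℝ) :
    iteratedDeriv 2 (fun s ↦ (F (r + s) + F (r - s)) / 2) t = (F₂ (r + t) + F₂ (r - t)) / 2 := by
  rw [iteratedDeriv_succ, iteratedDeriv_one]
  have hd : deriv (fun s ↦ (F (r + s) + F (r - s)) / 2) = fun s ↦ (F₁ (r + s) - F₁ (r - s)) / 2 :=
    funext fun s ↦ (hasDerivAt_slice_t hF r s).deriv
  rw [hd]
  have h1 : HasDerivAt (fun s ↦ F₁ (r + s)) (F₂ (r + t)) t := (hF₁ (r + t)).comp_const_add r t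
  have h2 : HasDerivAt (fun s ↦ F₁ (r - s)) (-F₂ (r - t)) t := (hF₁ (r - t)).comp_const_sub r t
  exact (((h1.sub h2).div_const 2).congr_deriv (by ring)).deriv

/-- The free field with even-in-`t` data has `∂ₜ = 0` at `t = 0`. [folklore] -/
theorem deriv_slice_t_zero (hF : ∀ x, HasDerivAt F (F₁ x) x) (r : ℝ) :
    deriv (fun s ↦ (F (r + s) + F (r - s)) / 2) 0 = 0 := by
  rw [(hasDerivAt_slice_t hF r 0).deriv]
  simp

/-- `r`-slice of the free field: first derivative. [folklore] -/
theorem hasDerivAt_slice_r (hF : ∀ x, HasDerivAt F (F₁ x) x) (t r : ℝ) :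
    HasDerivAt (fun x ↦ (F (x + t) + F (x - t)) / 2) ((F₁ (r + t) + F₁ (r - t)) / 2) r := by
  have h1 : HasDerivAt (fun x ↦ F (x + t)) (F₁ (r + t)) r := (hF (r + t)).comp_add_const r t
  have h2 : HasDerivAt (fun x ↦ F (x - t)) (F₁ (r - t)) r := (hF (r - t)).comp_sub_const r t
  exact (h1.add h2).div_const 2

/-- `∂ᵣ²` of the free field slice: `(F₂(r+t) + F₂(r−t))/2` (so `∂ₜ²χ = ∂ᵣ²χ`). [folklore] -/
theorem iteratedDeriv_two_slice_r (hF : ∀ x, HasDerivAt F (F₁ x) x)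
    (hF₁ : ∀ x, HasDerivAt F₁ (F₂ x) x) (t r : ℝ) :
    iteratedDeriv 2 (fun x ↦ (F (x + t) + F (x - t)) / 2) r = (F₂ (r + t) + F₂ (r - t)) / 2 := by
  rw [iteratedDeriv_succ, iteratedDeriv_one]
  have hd : deriv (fun x ↦ (F (x + t) + F (x - t)) / 2) = fun x ↦ (F₁ (x + t) + F₁ (x - t)) / 2 :=
    funext fun x ↦ (hasDerivAt_slice_r hF t x).deriv
  rw [hd]
  have h1 : HasDerivAt (fun x ↦ F₁ (x + t)) (F₂ (r + t)) r := (hF₁ (r + t)).comp_add_const r t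
  have h2 : HasDerivAt (fun x ↦ F₁ (x - t)) (F₂ (r - t)) r := (hF₁ (r - t)).comp_sub_const r t
  exact ((h1.add h2).div_const 2).deriv

end Slices

/-! ## §2 The smooth step and its primitive -/

/-- Mathlib's smooth step `S` (`= 0` on `(−∞,0]`, `= 1` on `[1,∞)`, monotone, `C^∞`). -/
abbrev S : ℝ → ℝ := Real.smoothTransition

/-- `S' = deriv S`. -/
abbrev S' : ℝ → ℝ := deriv Real.smoothTransition

/-- `S` is differentiable with derivative `S'`. [folklore] -/
theorem hasDerivAt_S (x : ℝ) : HasDerivAt S (S' x) x :=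
  (Literature.Analysis.Calculus.differentiable_smoothTransition x).hasDerivAt

/-- `S' ≥ 0` (`S` is monotone). [folklore] -/
theorem S'_nonneg (x : ℝ) : 0 ≤ S' x := Real.smoothTransition.monotone.deriv_nonneg

/-- `S' = 0` on `(−∞, 0]`. [folklore] -/
theorem S'_of_nonpos {x : ℝ} (hx : x ≤ 0) : S' x = 0 :=
  Literature.Analysis.Calculus.deriv_smoothTransition_of_nonpos hx

/-- `S' = 0` on `[1, ∞)`. [folklore] -/
theorem S'_of_one_le {x : ℝ} (hx : 1 ≤ x) : S' x = 0 :=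
  Literature.Analysis.Calculus.deriv_smoothTransition_of_one_le hx

/-- `S'` is continuous. [folklore] -/
theorem continuous_S' : Continuous S' :=
  (Real.smoothTransition.contDiff (n := 1)).continuous_deriv le_rfl

/-- `S'` is smooth. [folklore] -/
theorem contDiff_S' {n : ℕ∞} : ContDiff ℝ n S' := by
  have h := (Real.smoothTransition.contDiff (n := (⊤ : ℕ∞)))
  rw [contDiff_infty_iff_deriv] at h
  exact h.2.of_le (by exact_mod_cast le_top)

/-- The primitive `primStep x = ∫₀ˣ S`. -/
def primStep (x : ℝ) : ℝ := ∫ t in (0 : ℝ)..x, S t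

/-- `P' = S` (FTC). [folklore] -/
theorem hasDerivAt_primStep (x : ℝ) : HasDerivAt primStep (S x) x :=
  (Real.smoothTransition.continuous.integral_hasStrictDerivAt 0 x).hasDerivAt

/-- `primStep` is smooth (primitive of a smooth function). [folklore] -/
theorem contDiff_primStep {n : ℕ∞} : ContDiff ℝ n primStep := by
  have h : ContDiff ℝ (⊤ : ℕ∞) primStep := by
    rw [contDiff_infty_iff_deriv, show deriv primStep = S from funext fun x ↦ (hasDerivAt_primStep x).deriv]
    exact ⟨fun x ↦ (hasDerivAt_primStep x).differentiableAt, Real.smoothTransition.contDiff⟩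
  exact h.of_le (by exact_mod_cast le_top)

/-- `S` is interval integrable. [folklore] -/
theorem intervalIntegrable_S (a b : ℝ) : IntervalIntegrable S volume a b :=
  Real.smoothTransition.continuous.intervalIntegrable a b

/-- `primStep = 0` on `(−∞, 0]` (`S` vanishes there). [folklore] -/
theorem primStep_of_nonpos {x : ℝ} (hx : x ≤ 0) : primStep x = 0 := by
  unfold primStep
  rw [intervalIntegral.integral_symm, neg_eq_zero]
  apply intervalIntegral.integral_zero_ae
  filter_upwards with t ht
  rw [uIoc_of_le hx] at ht
  exact Real.smoothTransition.zero_of_nonpos ht.2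

/-- `primStep x = (x − 1) + primStep 1` for `x ≥ 1` (`S = 1` there). [folklore] -/
theorem primStep_of_one_le {x : ℝ} (hx : 1 ≤ x) : primStep x = (x - 1) + primStep 1 := by
  unfold primStep
  rw [← intervalIntegral.integral_add_adjacent_intervals (intervalIntegrable_S 0 1)
    (intervalIntegrable_S 1 x)]
  have : ∫ t in (1:ℝ)..x, S t = ∫ t in (1:ℝ)..x, (1:ℝ) := by
    apply intervalIntegral.integral_congr
    intro t ht
    rw [uIcc_of_le hx] at ht
    exact Real.smoothTransition.one_of_one_le ht.1
  rw [this, intervalIntegral.integral_const, smul_eq_mul, mul_one]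
  ring

/-- `primStep ≥ 0`. [folklore] -/
theorem primStep_nonneg (x : ℝ) : 0 ≤ primStep x := by
  rcases le_or_gt x 0 with hx | hx
  · rw [primStep_of_nonpos hx]
  · exact intervalIntegral.integral_nonneg hx.le fun t _ ↦ Real.smoothTransition.nonneg t

/-- `primStep x ≤ x` for `x ≥ 0` (`S ≤ 1`). [folklore] -/
theorem primStep_le_self {x : ℝ} (hx : 0 ≤ x) : primStep x ≤ x := by
  have h : ∫ t in (0:ℝ)..x, S t ≤ ∫ t in (0:ℝ)..x, (1:ℝ) :=
    intervalIntegral.integral_mono_on hx (intervalIntegrable_S 0 x) (by simp)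
      fun t _ ↦ Real.smoothTransition.le_one t
  rw [intervalIntegral.integral_const, smul_eq_mul, mul_one, sub_zero] at h
  exact h

/-! ## §3 The shelf profile `prof K` (odd, `= r/K` on `[0,K]`, constant beyond `K + 1`) -/

section Profile

variable (K : ℝ)

/-- The odd shelf profile: `prof K r = (r − primStep(r − K) + primStep(−r − K))/K`. -/
def prof (r : ℝ) : ℝ := (r - primStep (r - K) + primStep (-r - K)) / K

/-- Its first derivative. -/
def prof₁ (r : ℝ) : ℝ := (1 - S (r - K) - S (-r - K)) / K

/-- Its second derivative. -/
def prof₂ (r : ℝ) : ℝ := (-S' (r - K) + S' (-r - K)) / K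

/-- `prof' = prof₁`. [folklore] -/
theorem hasDerivAt_prof (r : ℝ) : HasDerivAt (prof K) (prof₁ K r) r := by
  have h1 : HasDerivAt (fun r ↦ primStep (r - K)) (S (r - K)) r := (hasDerivAt_primStep (r - K)).comp_sub_const r K
  have h2 : HasDerivAt (fun r ↦ primStep (-r - K)) (S (-r - K) * (-1)) r := by
    have := (hasDerivAt_primStep (-r - K)).comp r ((hasDerivAt_neg r).sub_const K)
    exact this
  have h := (((hasDerivAt_id r).sub h1).add h2).div_const K
  refine h.congr_deriv ?_
  unfold prof₁
  ring

/-- `prof₁' = prof₂`. [folklore] -/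
theorem hasDerivAt_prof₁ (r : ℝ) : HasDerivAt (prof₁ K) (prof₂ K r) r := by
  have h1 : HasDerivAt (fun r ↦ S (r - K)) (S' (r - K)) r := (hasDerivAt_S (r - K)).comp_sub_const r K
  have h2 : HasDerivAt (fun r ↦ S (-r - K)) (S' (-r - K) * (-1)) r := by
    have := (hasDerivAt_S (-r - K)).comp r ((hasDerivAt_neg r).sub_const K)
    exact this
  have h := (((hasDerivAt_const r (1:ℝ)).sub h1).sub h2).div_const K
  refine h.congr_deriv ?_
  unfold prof₂
  ring

/-- The profile is smooth. [folklore] -/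
theorem contDiff_prof {n : ℕ∞} : ContDiff ℝ n (prof K) := by
  unfold prof
  refine ContDiff.div_const ?_ K
  refine (contDiff_id.sub (contDiff_primStep.comp (contDiff_id.sub contDiff_const))).add
    (contDiff_primStep.comp (contDiff_neg.sub contDiff_const))

/-- The profile is odd. [folklore] -/
theorem prof_neg (r : ℝ) : prof K (-r) = -prof K r := by
  unfold prof
  rw [neg_neg]
  ring

/-- `prof K 0 = 0` (the Dirichlet trace on the cylinder). [folklore] -/
theorem prof_zero : prof K 0 = 0 := by
  have h := prof_neg K 0
  rw [neg_zero] at h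
  linarith

variable {K}

/-- For `r ≥ 0` the reflected primitive drops out. [folklore] -/
theorem prof_of_nonneg (hK : 0 ≤ K) {r : ℝ} (hr : 0 ≤ r) : prof K r = (r - primStep (r - K)) / K := by
  unfold prof
  rw [primStep_of_nonpos (by linarith : -r - K ≤ 0), add_zero]

/-- `prof K r = r/K` on `[0, K]`. [folklore] -/
theorem prof_of_le (hK : 0 ≤ K) {r : ℝ} (hr0 : 0 ≤ r) (hr : r ≤ K) : prof K r = r / K := by
  rw [prof_of_nonneg hK hr0, primStep_of_nonpos (by linarith : r - K ≤ 0), sub_zero]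

/-- `prof K` is the constant `(K + 1 − primStep 1)/K` on `[K+1, ∞)`. [folklore] -/
theorem prof_of_ge (hK : 0 ≤ K) {r : ℝ} (hr : K + 1 ≤ r) : prof K r = (K + 1 - primStep 1) / K := by
  rw [prof_of_nonneg hK (by linarith), primStep_of_one_le (by linarith : 1 ≤ r - K)]
  ring_nf

/-- `prof K ≥ 1` on `[K, ∞)` (so `|V| = |prof''|/prof ≤ |prof''|` there). [folklore] -/
theorem one_le_prof (hK : 0 < K) {r : ℝ} (hr : K ≤ r) : 1 ≤ prof K r := by
  rw [prof_of_nonneg hK.le (by linarith), le_div_iff₀ hK]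
  have := primStep_le_self (x := r - K) (by linarith)
  linarith

/-- `prof K ≥ 0` on `[0, ∞)`. [folklore] -/
theorem prof_nonneg (hK : 0 < K) {r : ℝ} (hr : 0 ≤ r) : 0 ≤ prof K r := by
  rcases le_or_gt r K with h | h
  · rw [prof_of_le hK.le hr h]; positivity
  · linarith [one_le_prof hK h.le]

/-- `prof K ≤ (K+1)/K` on `[0, ∞)` (the a-priori bound). [folklore] -/
theorem prof_le (hK : 0 < K) {r : ℝ} (hr : 0 ≤ r) : prof K r ≤ (K + 1) / K := by
  rw [prof_of_nonneg hK.le hr, div_le_div_iff_of_pos_right hK]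
  rcases le_or_gt r (K + 1) with h | h
  · linarith [primStep_nonneg (r - K)]
  · rw [primStep_of_one_le (by linarith : 1 ≤ r - K)]
    linarith [primStep_nonneg 1]

/-- `prof K K = 1` (the parked value: no decay at `r = K`). [folklore] -/
theorem prof_K (hK : 0 < K) : prof K K = 1 := by
  rw [prof_of_le hK.le hK.le le_rfl, div_self hK.ne']

/-- For `r ≥ 0`, `prof'' = −S'(r − K)/K`. [folklore] -/
theorem prof₂_of_nonneg (hK : 0 ≤ K) {r : ℝ} (hr : 0 ≤ r) : prof₂ K r = -S' (r - K) / K := by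
  unfold prof₂
  rw [S'_of_nonpos (by linarith : -r - K ≤ 0), add_zero]

/-- `prof'' = 0` on `[0, K]`. [folklore] -/
theorem prof₂_of_le (hK : 0 ≤ K) {r : ℝ} (hr0 : 0 ≤ r) (hr : r ≤ K) : prof₂ K r = 0 := by
  rw [prof₂_of_nonneg hK hr0, S'_of_nonpos (by linarith : r - K ≤ 0)]
  simp

end Profile

/-! ## §4 The witness fields and the Bargmann norm `≤ (K+1)/K` -/

section Witness

variable {K : ℝ}

/-- The radial majorant `ν K r = S'(r − K)/K` (supported in `[K, K+1]`). -/
def nu (K r : ℝ) : ℝ := S' (r - K) / K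

/-- The (time-independent) potential `V = prof'' / prof`. -/
def pot (K r : ℝ) : ℝ := prof₂ K r / prof K r

/-- `ν ≥ 0`. [folklore] -/
theorem nu_nonneg (hK : 0 < K) (r : ℝ) : 0 ≤ nu K r := div_nonneg (S'_nonneg _) hK.le

/-- `ν = 0` on `(−∞, K]`. [folklore] -/
theorem nu_of_lt (r : ℝ) (hr : r ≤ K) : nu K r = 0 := by
  unfold nu; rw [S'_of_nonpos (by linarith), zero_div]

/-- `ν = 0` on `[K+1, ∞)`. [folklore] -/
theorem nu_of_ge (r : ℝ) (hr : K + 1 ≤ r) : nu K r = 0 := by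
  unfold nu; rw [S'_of_one_le (by linarith), zero_div]

/-- `ν` is continuous. [folklore] -/
theorem continuous_nu : Continuous (nu K) :=
  (continuous_S'.comp (continuous_id.sub continuous_const)).div_const K

/-- `|V| ≤ ν` on `r ≥ 0`. [folklore] -/
theorem abs_pot_le_nu (hK : 0 < K) {r : ℝ} (hr : 0 ≤ r) : |pot K r| ≤ nu K r := by
  unfold pot
  rcases le_or_gt r K with h | h
  · rw [prof₂_of_le hK.le hr h, zero_div, abs_zero]
    exact nu_nonneg hK r
  · have hp : 1 ≤ prof K r := one_le_prof hK h.le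
    rw [prof₂_of_nonneg hK.le hr, abs_div, abs_of_pos (by linarith : 0 < prof K r)]
    calc |(-S' (r - K) / K)| / prof K r ≤ |(-S' (r - K) / K)| / 1 :=
          div_le_div_of_nonneg_left (abs_nonneg _) one_pos hp
      _ = nu K r := by
          rw [div_one, neg_div, abs_neg]
          exact abs_of_nonneg (nu_nonneg hK r)

/-- The zero-energy equation `V · prof = prof''` on `r ≥ 0`. [folklore] -/
theorem pot_mul_prof (hK : 0 < K) {r : ℝ} (hr : 0 ≤ r) : pot K r * prof K r = prof₂ K r := by
  unfold pot
  rcases le_or_gt r K with h | h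
  · rw [prof₂_of_le hK.le hr h]; simp
  · have hp : 1 ≤ prof K r := one_le_prof hK h.le
    exact div_mul_cancel₀ _ (by linarith)

/-- The profile is constant `= (K + 1 − primStep 1)/K` beyond `K + 1`, so the free field with the same
data vanishes identically in `{t − r ≥ K + 1}`. -/
theorem chi_vanish (hK : 0 < K) {t r : ℝ} (hr : 0 ≤ r) (h : K + 1 ≤ t - r) :
    (prof K (r + t) + prof K (r - t)) / 2 = 0 := by
  have h1 : prof K (r + t) = (K + 1 - primStep 1) / K := prof_of_ge hK.le (by linarith)
  have h2 : prof K (r - t) = -((K + 1 - primStep 1) / K) := by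
    rw [show r - t = -(t - r) by ring, prof_neg, prof_of_ge hK.le h]
  rw [h1, h2]; ring

/-- Support and integrability of the Bargmann integrand. -/
theorem hasCompactSupport_nu : HasCompactSupport (nu K) := by
  refine HasCompactSupport.intro (isCompact_Icc (a := K) (b := K + 1)) fun x hx ↦ ?_
  rw [mem_Icc, not_and_or, not_le, not_le] at hx
  rcases hx with h | h
  · exact nu_of_lt x h.le
  · exact nu_of_ge x h.le

/-- `ν` is integrable. [folklore] -/
theorem integrable_nu : Integrable (nu K) :=
  continuous_nu.integrable_of_hasCompactSupport hasCompactSupport_nu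

/-- The Bargmann integrand `(s − 0)ν(s)` is integrable. [folklore] -/
theorem integrable_bargmann : Integrable (fun s ↦ (s - 0) * nu K s) := by
  refine Continuous.integrable_of_hasCompactSupport
    ((continuous_id.sub continuous_const).mul continuous_nu) ?_
  exact hasCompactSupport_nu.mul_left

/-- `∫_{(0,∞)} S'(s − K)/K ds = 1/K` (FTC on `[0, ∞)`, `S(−K) = 0`, `S → 1`). -/
theorem integral_nu (hK : 0 < K) : ∫ s in Ioi 0, nu K s = 1 / K := by
  have hderiv : ∀ x ∈ Ioi (0:ℝ), HasDerivAt (fun s ↦ S (s - K) / K) (nu K x) x := fun x _ ↦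
    ((hasDerivAt_S (x - K)).comp_sub_const x K).div_const K
  have hlim : Tendsto (fun s ↦ S (s - K) / K) atTop (𝓝 (1 / K)) := by
    refine tendsto_const_nhds.congr' ?_
    filter_upwards [eventually_ge_atTop (K + 1)] with s hs
    have e : S (s - K) = 1 := Real.smoothTransition.one_of_one_le (by linarith)
    rw [e]
  have hcont : ContinuousWithinAt (fun s ↦ S (s - K) / K) (Ici 0) 0 :=
    ((Real.smoothTransition.continuous.comp (continuous_id.sub continuous_const)).div_const K)
      |>.continuousWithinAt
  rw [integral_Ioi_of_hasDerivAt_of_tendsto hcont hderiv integrable_nu.integrableOn hlim]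
  have e : S (0 - K) = 0 := Real.smoothTransition.zero_of_nonpos (by linarith)
  rw [e, zero_div, sub_zero]

/-- **Bargmann norm of the shelf: `∫₀^∞ (s − 0) ν ≤ (K + 1)/K`.** -/
theorem integral_bargmann_le (hK : 0 < K) : ∫ s in Ioi 0, (s - 0) * nu K s ≤ (K + 1) / K := by
  have hle : ∀ s ∈ Ioi (0:ℝ), (s - 0) * nu K s ≤ (K + 1) * nu K s := by
    intro s _
    rcases le_or_gt s (K + 1) with h | h
    · exact mul_le_mul_of_nonneg_right (by linarith) (nu_nonneg hK s)
    · rw [nu_of_ge s h.le]; simp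
  calc ∫ s in Ioi 0, (s - 0) * nu K s ≤ ∫ s in Ioi 0, (K + 1) * nu K s :=
        setIntegral_mono_on integrable_bargmann.integrableOn (integrable_nu.const_mul _).integrableOn
          measurableSet_Ioi hle
    _ = (K + 1) / K := by rw [integral_const_mul, integral_nu hK]; ring

end Witness

end Summit.FinalStateConjecture.FinalStateConjecture.Theorems.NecksCertify.Negative.Shelf

end
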